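import Literature.NumberTheory.LFunctions.KadiriFarZeroTail
import HarnessLib

/-!
# HANDOFF — the FAR-ZONE COST of the dodger by zero COUNTING: `Σ_ρ m(ρ)·e^{−a/γ²}/γ² ≤ N(√a)/(e·a) + B(0, √a)` (rh-explicit, track «HANDOFF», seat prove-2 gen9, ATTEMPT-16 Lemma C3, crude-constant kernel form)

HONEST FRAMING. Nothing here bears on the truth of RH; this is zero COUNTING. In ATTEMPT-16 (HOME/handoff/prove-2/ATTEMPT-16.md §4)
the far-zone cost of the dodger witness is, after Lemma C2 (FAR) (tree: `HandoffDodgerFarZone.farZone_normSq_le`), a sum over the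
unkilled zeros `ρ = β + iγ` of `h(γ) := e^{−a/γ²}/γ²` with `a = 2D₁′ ≍ T*³`. Lemma C3 bounds `Σ_{γ ≥ 2T_top} h(γ)` by partial summation
against `N(T)` with the sharp density `(1/2π)log(T/2π)`, getting `≈ 0.0705·a^{−1/2}·log a`. THIS FILE proves the same SHAPE with CRUDE
constants from the tree's unit-window counting (`KadiriTail.upper_sum_le`, every unit window carries `≤ 154 + 30 log(|u|+7)` zeros):
for every finite set `s` of zeros of `ζ` in the upper critical strip (`ζ ρ = 0`, `0 ≤ Re ρ ≤ 1`, `Im ρ > 0`) and every `a ≥ 16`,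

  `Σ_{ρ ∈ s} m(ρ)·e^{−a/(Im ρ)²}/(Im ρ)² ≤ N(√a)/(e·a) + B(0, √a)`,   `B = KadiriTail.tailBound`

(`far_cost_le`): below `√a` each term is at most the maximum `1/(e·a)` of `h` and there are `N(√a)` zeros (with multiplicity); above
`√a`, `h(γ) ≤ 1/γ²` and the tree's tail bound applies. Since `N(√a) = O(√a log a)` and `B(0, √a) = O(log a/√a)`, this is
`O(a^{−1/2} log a)` — Lemma C3's shape with a constant `≈ 200×` larger, which the (flexible) constants `(C, q₀)` of the typed target
`SubwindowZeroSumFamily C q₀` absorb. The bound is uniform in the truncation, as the zero-side domination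
`re_weilQuadratic_le_of_zeroSum_le` requires. No `sorry`, standard axioms, no definitions.

References: this track (ATTEMPT-16 §4, Lemma C3). H. Kadiri, Acta Arith. 117 (2005), Lemma 4.3 (the unit-window device; tree
`KadiriFarZeroTail`).
-/

set_option linter.dupNamespace false

noncomputable section

open Real Finset

namespace Summit.RiemannHypothesis.RiemannHypothesis.Theorems.Handoff

open Literature.NumberTheory.LFunctions Literature.NumberTheory.LFunctions.KadiriTail
  Literature.NumberTheory.LFunctions.SchoenfeldBound

/-! ## The weight `h(t) = e^{−a/t²}/t²` -/

/-- `x·e^{−x} ≤ 1/e` for all real `x` (from `x ≤ e^{x−1}`). [folklore] -/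
theorem mul_exp_neg_le_inv_exp (x : ℝ) : x * Real.exp (-x) ≤ 1 / Real.exp 1 := by
  have h1 : x ≤ Real.exp (x - 1) := by
    have := Real.add_one_le_exp (x - 1); linarith
  have h2 : Real.exp (x - 1) * Real.exp (-x) = 1 / Real.exp 1 := by
    rw [← Real.exp_add, show x - 1 + -x = -1 by ring, Real.exp_neg, one_div]
  calc x * Real.exp (-x) ≤ Real.exp (x - 1) * Real.exp (-x) :=
        mul_le_mul_of_nonneg_right h1 (Real.exp_pos _).le
    _ = 1 / Real.exp 1 := h2

/-- The global maximum of the weight: `e^{−a/t²}/t² ≤ 1/(e·a)` for `a > 0`, `t ≠ 0`. [folklore] -/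
theorem weight_le_inv (a t : ℝ) (ha : 0 < a) (ht : t ≠ 0) :
    Real.exp (-a / t ^ 2) / t ^ 2 ≤ 1 / (Real.exp 1 * a) := by
  have ht2 : 0 < t ^ 2 := by positivity
  have key := mul_exp_neg_le_inv_exp (a / t ^ 2)
  rw [show -(a / t ^ 2) = -a / t ^ 2 by ring] at key
  -- `(a/t²)·e^{−a/t²} ≤ 1/e`  ⟹  `e^{−a/t²}/t² ≤ 1/(e a)`
  rw [div_le_iff₀ ht2, one_div_mul_eq_div]
  rw [le_div_iff₀ (by positivity)]
  calc Real.exp (-a / t ^ 2) * (Real.exp 1 * a) = (a / t ^ 2 * Real.exp (-a / t ^ 2)) * Real.exp 1 * t ^ 2 := by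
        field_simp
    _ ≤ 1 / Real.exp 1 * Real.exp 1 * t ^ 2 := by gcongr
    _ = t ^ 2 := by field_simp

/-- Trivially `e^{−a/t²}/t² ≤ 1/t²` for `a ≥ 0`. [folklore] -/
theorem weight_le_inv_sq (a t : ℝ) (ha : 0 ≤ a) :
    Real.exp (-a / t ^ 2) / t ^ 2 ≤ 1 / t ^ 2 := by
  refine div_le_div_of_nonneg_right ?_ (sq_nonneg t)
  rw [Real.exp_le_one_iff, neg_div]
  exact neg_nonpos.2 (div_nonneg ha (sq_nonneg t))

/-! ## The count below `√a` -/

/-- For a finite set of zeros in the upper strip with `Im ρ ≤ Y` (`Y ≥ 0`): `Σ_{ρ ∈ s} m(ρ) ≤ N(Y)`. [folklore] -/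
theorem sum_zeroOrder_le_zetaZeroCount {Y : ℝ} (hY : 0 ≤ Y) (s : Finset ℂ)
    (hs : ∀ ρ ∈ s, riemannZeta ρ = 0 ∧ 0 ≤ ρ.re ∧ ρ.re ≤ 1 ∧ 0 < ρ.im ∧ ρ.im ≤ Y) :
    ∑ ρ ∈ s, (riemannZetaZeroOrder ρ : ℝ) ≤ zetaZeroCount Y := by
  classical
  have hsub : s ⊆ zerosBetween 0 Y := by
    intro ρ hρ
    obtain ⟨hz, h1, h2, h3, h4⟩ := hs ρ hρ
    exact (mem_zerosBetween le_rfl).2 ⟨hz, h1, h2, h3, h4⟩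
  have h1 : ∑ ρ ∈ s, (riemannZetaZeroOrder ρ : ℝ) ≤ ∑ ρ ∈ zerosBetween 0 Y, (riemannZetaZeroOrder ρ : ℝ) :=
    sum_le_sum_of_subset_of_nonneg hsub fun ρ hρ _ ↦ zeroOrder_nonneg_of_mem_zerosBetween le_rfl hρ
  rw [← zetaZeroCount_sub_eq_sum hY, zetaZeroCount_eq_zero_of_nonpos le_rfl] at h1
  simpa using h1

/-! ## Lemma C3, crude-constant kernel form -/

/-- **ATTEMPT-16 Lemma C3 (crude constants, kernel).** For `a ≥ 16` and every finite set `s` of zeros of `ζ` in the upper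
critical strip: `Σ_{ρ ∈ s} m(ρ)·e^{−a/(Im ρ)²}/(Im ρ)² ≤ N(√a)/(e·a) + B(0, √a)` (`B = KadiriTail.tailBound`; uniform in `s`).
[this track, ATTEMPT-16 Lemma C3] -/
theorem far_cost_le {a : ℝ} (ha : 16 ≤ a) (s : Finset ℂ)
    (hs : ∀ ρ ∈ s, riemannZeta ρ = 0 ∧ 0 ≤ ρ.re ∧ ρ.re ≤ 1 ∧ 0 < ρ.im) :
    ∑ ρ ∈ s, (riemannZetaZeroOrder ρ : ℝ) * (Real.exp (-a / ρ.im ^ 2) / ρ.im ^ 2) ≤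
      (zetaZeroCount (Real.sqrt a) : ℝ) / (Real.exp 1 * a) + tailBound |(0 : ℝ)| (Real.sqrt a) := by
  classical
  have ha0 : 0 < a := by linarith
  have hsa : 4 ≤ Real.sqrt a := by
    rw [show (4 : ℝ) = Real.sqrt 16 by rw [show (16 : ℝ) = 4 ^ 2 by norm_num, Real.sqrt_sq (by norm_num)]]
    exact Real.sqrt_le_sqrt ha
  have hsa0 : 0 ≤ Real.sqrt a := Real.sqrt_nonneg a
  set s₁ : Finset ℂ := s.filter (fun ρ ↦ ρ.im ≤ Real.sqrt a) with hs₁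
  set s₂ : Finset ℂ := s.filter (fun ρ ↦ ¬ ρ.im ≤ Real.sqrt a) with hs₂
  have hm0 : ∀ ρ ∈ s, (0 : ℝ) ≤ riemannZetaZeroOrder ρ := fun ρ hρ ↦ by
    obtain ⟨hz, -, -, him⟩ := hs ρ hρ
    exact_mod_cast zero_le_one.trans (ZetaZeros.riemannZetaNontrivialZeros.one_le_order
      (ZetaZeros.riemannZetaNontrivialZeros.mem_of_im_ne_zero hz him.ne'))
  rw [← sum_filter_add_sum_filter_not s (fun ρ ↦ ρ.im ≤ Real.sqrt a)]
  refine add_le_add ?_ ?_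
  · -- below `√a`: each weight ≤ `1/(e a)`, total multiplicity ≤ `N(√a)`
    calc ∑ ρ ∈ s₁, (riemannZetaZeroOrder ρ : ℝ) * (Real.exp (-a / ρ.im ^ 2) / ρ.im ^ 2)
        ≤ ∑ ρ ∈ s₁, (riemannZetaZeroOrder ρ : ℝ) * (1 / (Real.exp 1 * a)) := by
          refine sum_le_sum fun ρ hρ ↦ ?_
          have hρs := (mem_filter.1 hρ).1
          exact mul_le_mul_of_nonneg_left (weight_le_inv a ρ.im ha0 (hs ρ hρs).2.2.2.ne') (hm0 ρ hρs)
      _ = (∑ ρ ∈ s₁, (riemannZetaZeroOrder ρ : ℝ)) / (Real.exp 1 * a) := by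
          rw [sum_div]; refine sum_congr rfl fun ρ _ ↦ ?_; ring
      _ ≤ (zetaZeroCount (Real.sqrt a) : ℝ) / (Real.exp 1 * a) := by
          refine div_le_div_of_nonneg_right (sum_zeroOrder_le_zetaZeroCount hsa0 s₁ fun ρ hρ ↦ ?_) (by positivity)
          obtain ⟨hρs, hle⟩ := mem_filter.1 hρ
          obtain ⟨hz, h1, h2, h3⟩ := hs ρ hρs
          exact ⟨hz, h1, h2, h3, hle⟩
  · -- above `√a`: weight ≤ `1/γ²`, then the unit-window tail bound with `c = 0`, `t₀ = √a`
    calc ∑ ρ ∈ s₂, (riemannZetaZeroOrder ρ : ℝ) * (Real.exp (-a / ρ.im ^ 2) / ρ.im ^ 2)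
        ≤ ∑ ρ ∈ s₂, (riemannZetaZeroOrder ρ : ℝ) / (ρ.im - 0) ^ 2 := by
          refine sum_le_sum fun ρ hρ ↦ ?_
          have hρs := (mem_filter.1 hρ).1
          calc (riemannZetaZeroOrder ρ : ℝ) * (Real.exp (-a / ρ.im ^ 2) / ρ.im ^ 2)
              ≤ (riemannZetaZeroOrder ρ : ℝ) * (1 / ρ.im ^ 2) :=
                mul_le_mul_of_nonneg_left (weight_le_inv_sq a ρ.im ha0.le) (hm0 ρ hρs)
            _ = (riemannZetaZeroOrder ρ : ℝ) / (ρ.im - 0) ^ 2 := by rw [sub_zero]; ring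
      _ ≤ tailBound |(0 : ℝ)| (Real.sqrt a) := by
          refine upper_sum_le hsa s₂ fun ρ hρ ↦ ?_
          obtain ⟨hρs, hgt⟩ := mem_filter.1 hρ
          obtain ⟨hz, h1, h2, h3⟩ := hs ρ hρs
          exact ⟨hz, h1, h2, h3, by rw [zero_add]; exact (lt_of_not_ge hgt).le⟩

/-- The size of the crude bound, for the record: `B(0, √a) ≤ 220·(log(√a) + 1)/√a` for `a ≥ 16`
(so `far_cost_le`'s right side is `O(a^{−1/2} log a)`, given `N(√a) = O(√a log a)`). [folklore] -/
theorem tailBound_zero_le {a : ℝ} (ha : 16 ≤ a) :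
    tailBound |(0 : ℝ)| (Real.sqrt a) ≤ 220 * (Real.log (Real.sqrt a) + 1) / Real.sqrt a := by
  have hsa : 4 ≤ Real.sqrt a := by
    rw [show (4 : ℝ) = Real.sqrt 16 by rw [show (16 : ℝ) = 4 ^ 2 by norm_num, Real.sqrt_sq (by norm_num)]]
    exact Real.sqrt_le_sqrt ha
  set Y : ℝ := Real.sqrt a with hY
  have hY0 : 0 < Y := by linarith
  have he1 := Real.exp_one_gt_d9
  have he2 := Real.exp_one_lt_d9
  have hl7 : Real.log 7 ≤ 2 := by
    rw [Real.log_le_iff_le_exp (by norm_num : (0 : ℝ) < 7)]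
    have h2 : Real.exp 2 = Real.exp 1 * Real.exp 1 := by rw [← Real.exp_add]; norm_num
    rw [h2]; nlinarith
  have hlY1 : 1 ≤ Real.log Y := by
    rw [Real.le_log_iff_exp_le hY0]; linarith
  have hlY : 0 ≤ Real.log Y := by linarith
  unfold tailBound
  rw [abs_zero, zero_add, le_div_iff₀ hY0]
  have e : ((154 + 30 * Real.log 7) * (1 / Y ^ 2 + 1 / Y) + 30 * (Real.log Y / Y ^ 2 + (Real.log Y + 1) / Y)) * Y =
      (154 + 30 * Real.log 7) * (1 / Y + 1) + 30 * (Real.log Y / Y + (Real.log Y + 1)) := by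
    field_simp
  rw [e]
  have h1 : 1 / Y ≤ 1 / 4 := div_le_div_of_nonneg_left zero_le_one (by norm_num) hsa
  have h2 : Real.log Y / Y ≤ Real.log Y / 4 := div_le_div_of_nonneg_left hlY (by norm_num) hsa
  have hA : 154 + 30 * Real.log 7 ≤ 214 := by linarith
  have hA0 : 0 ≤ 154 + 30 * Real.log 7 := by
    have : 0 ≤ Real.log 7 := Real.log_nonneg (by norm_num); linarith
  have h3 : (154 + 30 * Real.log 7) * (1 / Y + 1) ≤ 214 * (1 / 4 + 1) :=
    mul_le_mul hA (by linarith) (by positivity) (by norm_num)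
  nlinarith

end Summit.RiemannHypothesis.RiemannHypothesis.Theorems.Handoff

end
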